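import Literature.Geometry.Symplectic.WedgeBracketFour
import Literature.Geometry.Symplectic.PfaffianWedgeFour
import Literature.Geometry.Kaehler.PoincareLemmaStarConvex
import Literature.Geometry.Kaehler.PoincareLemmaOneJet
import Mathlib.Analysis.Calculus.DifferentialForm.Basic
import Mathlib.Analysis.Calculus.FDeriv.CompCLM
import Mathlib.Analysis.Calculus.MeanValue

/-!
# Small spheres around a point of a symplectic chart are contact type, hence stable

Topic `Literature/Geometry/Symplectic`.  For a closed nondegenerate 2-form `Ωc` on a ball of
`ℝ⁴` (the chart representative of a symplectic form), the spheres `S_r(c) = {c + r u : ‖u‖ = 1}`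
of small radius around the centre `c` are of CONTACT TYPE for `Ωc`: the rescaled radial
(cone / homotopy-operator) primitive `θ_r(u) = r⁻¹ (K Ωc)(c + r u)` of `Ωc` restricts to a contact
form on the unit sphere whose differential is the rescaled trace `σ_r(u) = Ωc(c + r u)|_{u^⊥}`
EXACTLY (`d K Ωc = Ωc`, Poincaré lemma), and whose contact condition `θ_r ∧ σ_r ≠ 0` on the
tangent 3-planes `u^⊥` follows, for small `r`, by a perturbation argument from the linear model
`θ₀(u) = ½ Ωc(c)(u, ·)`, `σ₀ = Ωc(c)`, where `(θ₀ ∧ σ₀)|_{u^⊥} = ½ Pf(Ωc(c)) det[u, ·, ·, ·] ≠ 0`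
(Pfaffian identity).  In the orientation-free chart language of the line `stable-seam-host`
(crux `OrigamiFoldExistence`, Summit SmoothPoincare4) this says: the two STABILITY CLAUSES
(Cieliebak–Volkov) hold for `(σ_r, θ_r)` with a GLOBAL smooth `θ` (a cut-off of `θ_r`).

Main statements: `exists_isStabilising_smallSphere_of` — the above, with the three elementary
inputs (1-jet of the cone primitive; Pfaffian identity and non-vanishing; top forms on a
hyperplane) as hypotheses in the exact form in which the tree states them — and the
unconditional `exists_isStabilising_smallSphere`, discharging them by the tree theorems
`Literature.Geometry.Kaehler.coneOperator_two_oneJet`, `Literature.Geometry.Symplectic.pfaffian_identity_four`,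
`pfaffian_ne_zero_of_nondegenerate_four`, `alternating_three_restrict_orthogonal_four`.

References: McDuff–Salamon, *Introduction to Symplectic Topology* (3rd ed. 2017), §3.5
(contact type hypersurfaces, Liouville fields: every point has a neighbourhood basis of balls with
convex boundary); Cieliebak–Volkov, JEMS 17 (2015), §1 (contact ⇒ stable); Bott–Tu §I.4 (cone
operator).
-/

noncomputable section

open scoped ContDiff Topology RealInnerProductSpace
open Set Metric Function

namespace Literature.Geometry.Symplectic


/-! ### Preliminaries: evaluation of 1-forms, `d` of a 1-form, the trilinear bracket -/

/-- The evaluation of continuous alternating `1`-forms on `ℝ⁴` at vectors, `γ ↦ (w ↦ γ ![w])`, is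
(the coercion of) a continuous linear map into `ℝ⁴ →L ℝ` (stated as an existence so that no
definition is added). [folklore] -/
theorem exists_evalOneFormCLM :
    ∃ T : ((EuclideanSpace ℝ (Fin 4)) [⋀^Fin 1]→L[ℝ] ℝ) →L[ℝ] ((EuclideanSpace ℝ (Fin 4)) →L[ℝ] ℝ),
      ∀ (γ : (EuclideanSpace ℝ (Fin 4)) [⋀^Fin 1]→L[ℝ] ℝ) (w : (EuclideanSpace ℝ (Fin 4))), T γ w = γ ![w] := by
  refine ⟨((ContinuousMultilinearMap.ofSubsingletonₗᵢ (G' := ℝ) ℝ (EuclideanSpace ℝ (Fin 4)) (0 : Fin 1)).symm.toLinearIsometry.toContinuousLinearMap).comp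
    (ContinuousAlternatingMap.toContinuousMultilinearMapCLM ℝ), fun γ w => ?_⟩
  simp only [ContinuousLinearMap.coe_comp, Function.comp_apply,
    LinearIsometry.coe_toContinuousLinearMap, LinearIsometryEquiv.coe_toLinearIsometry]
  rw [ContinuousMultilinearMap.ofSubsingletonₗᵢ_symm_apply]
  change ((ContinuousMultilinearMap.ofSubsingleton ℝ (EuclideanSpace ℝ (Fin 4)) ℝ (0 : Fin 1)).symm
    γ.toContinuousMultilinearMap) w = γ ![w]
  rw [ContinuousMultilinearMap.ofSubsingleton_symm_apply_apply]
  change γ (fun _ => w) = γ ![w]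
  congr 1
  funext i
  fin_cases i
  rfl

/-- `d` of a `1`-form on pairs: `dΛ(x)(v, w) = (D_v Λ)(w) - (D_w Λ)(v)` (Mathlib's normalisation
of `extDeriv`). [folklore] -/
theorem extDeriv_one_apply_two (Λ : (EuclideanSpace ℝ (Fin 4)) → (EuclideanSpace ℝ (Fin 4)) [⋀^Fin 1]→L[ℝ] ℝ) {x : (EuclideanSpace ℝ (Fin 4))}
    (h : DifferentiableAt ℝ Λ x) (v w : (EuclideanSpace ℝ (Fin 4))) :
    extDeriv Λ x ![v, w] = fderiv ℝ Λ x v ![w] - fderiv ℝ Λ x w ![v] := by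
  rw [extDeriv_apply h, Fin.sum_univ_succ, Fin.sum_univ_one]
  have h0 : (Fin.removeNth 0 ![v, w] : Fin 1 → (EuclideanSpace ℝ (Fin 4))) = ![w] := by
    funext i; fin_cases i; rfl
  have h1 : (Fin.removeNth (Fin.succ 0) ![v, w] : Fin 1 → (EuclideanSpace ℝ (Fin 4))) = ![v] := by
    funext i; fin_cases i; rfl
  rw [h0, h1, fderiv_continuousAlternatingMap_apply_const h,
    fderiv_continuousAlternatingMap_apply_const h]
  simp only [Fin.val_zero, pow_zero, one_smul, Matrix.cons_val_zero, Fin.succ_zero_eq_one,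
    Fin.val_one, pow_one, Matrix.cons_val_one, neg_smul,
    ContinuousLinearMap.flipAlternating_apply_apply]
  abel

/-! ### The rescaled primitive `θ_r(u) = r⁻¹ T(Λ(c + r u))` and its exterior derivative -/

/-- DERIVATIVE OF THE RESCALED 1-FORM.  For `θ(u) = r⁻¹ • T (Λ (c + r • u))` (`T` the evaluation
functional), `D_v θ(u)(w) - D_w θ(u)(v) = dΛ(c + r u)(v, w)`: the factors `r⁻¹` and `r` cancel.
[folklore] -/
theorem fderiv_rescaled_sub (T : ((EuclideanSpace ℝ (Fin 4)) [⋀^Fin 1]→L[ℝ] ℝ) →L[ℝ] ((EuclideanSpace ℝ (Fin 4)) →L[ℝ] ℝ))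
    (hT : ∀ (γ : (EuclideanSpace ℝ (Fin 4)) [⋀^Fin 1]→L[ℝ] ℝ) (w : (EuclideanSpace ℝ (Fin 4))), T γ w = γ ![w])
    (Λ : (EuclideanSpace ℝ (Fin 4)) → (EuclideanSpace ℝ (Fin 4)) [⋀^Fin 1]→L[ℝ] ℝ) (c : (EuclideanSpace ℝ (Fin 4))) {r : ℝ} (hr : r ≠ 0) (u : (EuclideanSpace ℝ (Fin 4)))
    (hΛ : DifferentiableAt ℝ Λ (c + r • u)) (v w : (EuclideanSpace ℝ (Fin 4))) :
    fderiv ℝ (fun u : (EuclideanSpace ℝ (Fin 4)) => r⁻¹ • T (Λ (c + r • u))) u v w -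
        fderiv ℝ (fun u : (EuclideanSpace ℝ (Fin 4)) => r⁻¹ • T (Λ (c + r • u))) u w v =
      extDeriv Λ (c + r • u) ![v, w] := by
  -- the affine reparametrisation `A u = c + r • u` and its derivative `r • id`
  have hA : HasFDerivAt (fun u : (EuclideanSpace ℝ (Fin 4)) => c + r • u) (r • ContinuousLinearMap.id ℝ (EuclideanSpace ℝ (Fin 4))) u := by
    have h1 : HasFDerivAt (fun u : (EuclideanSpace ℝ (Fin 4)) => r • u) (r • ContinuousLinearMap.id ℝ (EuclideanSpace ℝ (Fin 4))) u :=
      (ContinuousLinearMap.id ℝ (EuclideanSpace ℝ (Fin 4))).hasFDerivAt.const_smul r |>.congr_fderiv (by simp)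
    exact (h1.const_add c)
  have hΛA : HasFDerivAt (fun u : (EuclideanSpace ℝ (Fin 4)) => Λ (c + r • u))
      ((fderiv ℝ Λ (c + r • u)).comp (r • ContinuousLinearMap.id ℝ (EuclideanSpace ℝ (Fin 4)))) u :=
    hΛ.hasFDerivAt.comp u hA
  have hθ : HasFDerivAt (fun u : (EuclideanSpace ℝ (Fin 4)) => r⁻¹ • T (Λ (c + r • u)))
      (r⁻¹ • T.comp ((fderiv ℝ Λ (c + r • u)).comp (r • ContinuousLinearMap.id ℝ (EuclideanSpace ℝ (Fin 4))))) u :=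
    (T.hasFDerivAt.comp u hΛA).const_smul r⁻¹
  rw [hθ.fderiv]
  simp only [FunLike.coe_smul, Pi.smul_apply, ContinuousLinearMap.coe_comp,
    Function.comp_apply, map_smul, smul_smul, inv_mul_cancel₀ hr, one_smul, hT]
  exact (extDeriv_one_apply_two Λ hΛ v w).symm

/-! ### Cut-offs: globalising a map smooth near the closed unit ball -/

/-- A map `C^∞` on the open ball of radius `2` agrees near the closed unit ball with a GLOBAL
`C^∞` map (multiply by a smooth cut-off equal to `1` near the closed unit ball and supported in
the open ball; smooth Urysohn). [folklore] -/
theorem exists_contDiff_eventuallyEq_of_contDiffOn_ball {F : Type*} [NormedAddCommGroup F]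
    [NormedSpace ℝ F] {f : (EuclideanSpace ℝ (Fin 4)) → F} (hf : ContDiffOn ℝ ∞ f (ball (0 : (EuclideanSpace ℝ (Fin 4))) 2)) :
    ∃ g : (EuclideanSpace ℝ (Fin 4)) → F, ContDiff ℝ ∞ g ∧ ∀ u ∈ closedBall (0 : (EuclideanSpace ℝ (Fin 4))) 1, g =ᶠ[𝓝 u] f := by
  obtain ⟨ψ, hψ, h1, h0⟩ := Literature.Geometry.Kaehler.exists_contDiff_one_nhdsSet_of_isCompact
    (isCompact_closedBall (0 : (EuclideanSpace ℝ (Fin 4))) 1) isOpen_ball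
    (closedBall_subset_ball (by norm_num : (1 : ℝ) < 2))
  refine ⟨fun y => ψ y • f y, ?_, ?_⟩
  · refine contDiff_iff_contDiffAt.2 fun y => ?_
    by_cases hy : y ∈ ball (0 : (EuclideanSpace ℝ (Fin 4))) 2
    · exact hψ.contDiffAt.smul (hf.contDiffAt (isOpen_ball.mem_nhds hy))
    · have h : (fun y => ψ y • f y) =ᶠ[𝓝 y] fun _ => 0 := by
        have h0' : ∀ᶠ z in 𝓝 y, ψ z = 0 := h0.filter_mono (nhds_le_nhdsSet hy)
        filter_upwards [h0'] with z hz
        rw [hz, zero_smul]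
      exact (contDiffAt_const (c := (0 : F))).congr_of_eventuallyEq h
  · intro u hu
    have h1' : ∀ᶠ z in 𝓝 u, ψ z = 1 := h1.filter_mono (nhds_le_nhdsSet hu)
    filter_upwards [h1'] with z hz
    rw [hz, one_smul]

/-! ### The main theorem: small spheres are stabilised -/

/-- Operator-norm bound for a difference of rescaled covectors: if
`|α a - α₀ a| ≤ K ‖a‖` for all `a` then `‖α - α₀‖ ≤ K`. [folklore] -/
theorem opNorm_sub_le_of_bound (α α₀ : (EuclideanSpace ℝ (Fin 4)) →L[ℝ] ℝ) {K : ℝ} (hK : 0 ≤ K)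
    (h : ∀ a, |α a - α₀ a| ≤ K * ‖a‖) : ‖α - α₀‖ ≤ K :=
  ContinuousLinearMap.opNorm_le_bound _ hK fun a => by
    rw [sub_apply, Real.norm_eq_abs]
    exact h a

/-- **SMALL SPHERES AROUND A POINT OF A SYMPLECTIC CHART ARE STABILISED (indeed contact type)**,
relative to the three elementary inputs `hcone` (1-jet of the cone primitive), `hPf`/`hPfnz`
(Pfaffian identity on `ℝ⁴` and non-vanishing of the Pfaffian of a nondegenerate form) and `hprop`
(alternating trilinear forms on a hyperplane are `det`-proportional, with bound), each in the exact
form the tree states it.  For a 2-form `Ωc` on `ℝ⁴`, `C^∞`, closed and nondegenerate on the ball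
`B(c, ρ)`, there is `r₁ > 0` such that for every `0 < r < r₁` the unit-sphere trace
`σ(u)(v, w) = Ωc(c + r u)(v, w)` admits a GLOBAL smooth `θ : ℝ⁴ → (ℝ⁴ →L ℝ)` with
(i) `θ ∧ σ ≠ 0` on every linearly independent tangent triple `v ⊥ u`, and (ii)
`ker σ(u)|_{u^⊥} ⊂ ker dθ(u)` on `u^⊥` — the two stability clauses of Cieliebak–Volkov written
in the chart.  Proof: `θ = r⁻¹ (K Ωc)(c + r ·)` cut off away from the sphere; (ii) holds because
`dθ = σ` exactly (`d K Ωc = Ωc`, the tree's Poincaré lemma on the star-shaped ball); (i) by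
`bracket_ne_zero_of_perturbation` at scale `r`, the model being `θ₀(u) = ½ Ωc(c)(u, ·)`.
McDuff–Salamon (2017) §3.5; Cieliebak–Volkov (2015) §1. [cite: McDuffSalamon2017, §3.5] -/
theorem exists_isStabilising_smallSphere_of
    (hcone : ∀ (β : (EuclideanSpace ℝ (Fin 4)) → (EuclideanSpace ℝ (Fin 4)) [⋀^Fin 2]→L[ℝ] ℝ) (c : (EuclideanSpace ℝ (Fin 4))) (ρ : ℝ), 0 < ρ →
      ContDiffOn ℝ ∞ β (ball c ρ) → ∃ C : ℝ, ∀ x ∈ closedBall c (ρ / 2), ∀ v : (EuclideanSpace ℝ (Fin 4)),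
        |Literature.Geometry.Kaehler.coneOperator c β x ![v] - 2⁻¹ * β c ![x - c, v]| ≤
          C * ‖x - c‖ ^ 2 * ‖v‖)
    (hPf : ∀ (Ω : (EuclideanSpace ℝ (Fin 4)) [⋀^Fin 2]→L[ℝ] ℝ) (w : Fin 4 → (EuclideanSpace ℝ (Fin 4))),
      Ω ![w 0, w 1] * Ω ![w 2, w 3] - Ω ![w 0, w 2] * Ω ![w 1, w 3] + Ω ![w 0, w 3] * Ω ![w 1, w 2] =
        (Ω ![EuclideanSpace.single 0 1, EuclideanSpace.single 1 1] *
            Ω ![EuclideanSpace.single 2 1, EuclideanSpace.single 3 1] -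
          Ω ![EuclideanSpace.single 0 1, EuclideanSpace.single 2 1] *
            Ω ![EuclideanSpace.single 1 1, EuclideanSpace.single 3 1] +
          Ω ![EuclideanSpace.single 0 1, EuclideanSpace.single 3 1] *
            Ω ![EuclideanSpace.single 1 1, EuclideanSpace.single 2 1]) *
          (Matrix.of fun i j => w i j).det)
    (hPfnz : ∀ (Ω : (EuclideanSpace ℝ (Fin 4)) [⋀^Fin 2]→L[ℝ] ℝ), (∀ v : (EuclideanSpace ℝ (Fin 4)), v ≠ 0 → ∃ w, Ω ![v, w] ≠ 0) →
      Ω ![EuclideanSpace.single 0 1, EuclideanSpace.single 1 1] *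
            Ω ![EuclideanSpace.single 2 1, EuclideanSpace.single 3 1] -
          Ω ![EuclideanSpace.single 0 1, EuclideanSpace.single 2 1] *
            Ω ![EuclideanSpace.single 1 1, EuclideanSpace.single 3 1] +
          Ω ![EuclideanSpace.single 0 1, EuclideanSpace.single 3 1] *
            Ω ![EuclideanSpace.single 1 1, EuclideanSpace.single 2 1] ≠ 0)
    (hprop : ∀ (R : (EuclideanSpace ℝ (Fin 4)) → (EuclideanSpace ℝ (Fin 4)) → (EuclideanSpace ℝ (Fin 4)) → ℝ), (∀ b c, IsLinearMap ℝ fun a => R a b c) →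
      (∀ a c, IsLinearMap ℝ fun b => R a b c) → (∀ a b, IsLinearMap ℝ fun c => R a b c) →
      (∀ a b c, R b a c = - R a b c) → (∀ a b c, R a c b = - R a b c) →
      ∀ u : (EuclideanSpace ℝ (Fin 4)), ‖u‖ = 1 → ∃ κ : ℝ, (∀ v : Fin 3 → (EuclideanSpace ℝ (Fin 4)), (∀ i, ⟪v i, u⟫ = 0) →
        R (v 0) (v 1) (v 2) = κ * (Matrix.of fun i j => (Fin.cons u v : Fin 4 → (EuclideanSpace ℝ (Fin 4))) i j).det) ∧
        ∀ δ : ℝ, (∀ a b c, |R a b c| ≤ δ * ‖a‖ * ‖b‖ * ‖c‖) → |κ| ≤ δ)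
    (Ωc : (EuclideanSpace ℝ (Fin 4)) → (EuclideanSpace ℝ (Fin 4)) [⋀^Fin 2]→L[ℝ] ℝ) (c : (EuclideanSpace ℝ (Fin 4))) (ρ : ℝ) (hρ : 0 < ρ)
    (hs : ContDiffOn ℝ ∞ Ωc (ball c ρ)) (hcl : ∀ y ∈ ball c ρ, extDeriv Ωc y = 0)
    (hnd : ∀ y ∈ ball c ρ, ∀ v : (EuclideanSpace ℝ (Fin 4)), v ≠ 0 → ∃ w, Ωc y ![v, w] ≠ 0) :
    ∃ r₁ : ℝ, 0 < r₁ ∧ ∀ r : ℝ, 0 < r → r < r₁ →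
      ∃ θ : (EuclideanSpace ℝ (Fin 4)) → (EuclideanSpace ℝ (Fin 4)) →L[ℝ] ℝ, ContDiff ℝ ∞ θ ∧
        (∀ u : (EuclideanSpace ℝ (Fin 4)), ‖u‖ = 1 → ∀ v : Fin 3 → (EuclideanSpace ℝ (Fin 4)), (∀ i, ⟪v i, u⟫ = 0) → LinearIndependent ℝ v →
          θ u (v 0) * Ωc (c + r • u) ![v 1, v 2] - θ u (v 1) * Ωc (c + r • u) ![v 0, v 2] +
            θ u (v 2) * Ωc (c + r • u) ![v 0, v 1] ≠ 0) ∧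
        (∀ u : (EuclideanSpace ℝ (Fin 4)), ‖u‖ = 1 → ∀ v : (EuclideanSpace ℝ (Fin 4)), ⟪v, u⟫ = 0 →
          (∀ w : (EuclideanSpace ℝ (Fin 4)), ⟪w, u⟫ = 0 → Ωc (c + r • u) ![v, w] = 0) →
          ∀ w : (EuclideanSpace ℝ (Fin 4)), ⟪w, u⟫ = 0 → fderiv ℝ θ u v w - fderiv ℝ θ u w v = 0) := by
  obtain ⟨T, hT⟩ := exists_evalOneFormCLM
  -- the cone primitive `Λ = K Ωc`: smooth, `dΛ = Ωc` on the ball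
  set Λ : (EuclideanSpace ℝ (Fin 4)) → (EuclideanSpace ℝ (Fin 4)) [⋀^Fin 1]→L[ℝ] ℝ := Literature.Geometry.Kaehler.coneOperator c Ωc with hΛ
  have hst : StarConvex ℝ c (ball c ρ) := (convex_ball c ρ).starConvex (mem_ball_self hρ)
  have hΛs : ContDiffOn ℝ ∞ Λ (ball c ρ) :=
    Literature.Geometry.Kaehler.contDiffOn_coneOperator isOpen_ball hst hs
  have hdΛ : ∀ x ∈ ball c ρ, extDeriv Λ x = Ωc x := fun x hx =>
    Literature.Geometry.Kaehler.extDeriv_coneOperator_of_extDeriv_eq_zero isOpen_ball hst hs hcl hx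
  -- the 1-jet constant `C ≥ 0`
  obtain ⟨C₀, hC₀⟩ := hcone Ωc c ρ hρ hs
  set C : ℝ := max C₀ 0 with hCdef
  have hC0 : 0 ≤ C := le_max_right _ _
  have hC : ∀ x ∈ closedBall c (ρ / 2), ∀ v : (EuclideanSpace ℝ (Fin 4)),
      |Λ x ![v] - 2⁻¹ * Ωc c ![x - c, v]| ≤ C * ‖x - c‖ ^ 2 * ‖v‖ := fun x hx v =>
    (hC₀ x hx v).trans (by gcongr; exact le_max_left _ _)
  -- the model form `Ω₀ = Ωc c` and its Pfaffian `P ≠ 0`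
  set Ω₀ : (EuclideanSpace ℝ (Fin 4)) [⋀^Fin 2]→L[ℝ] ℝ := Ωc c with hΩ₀
  set P : ℝ := Ω₀ ![EuclideanSpace.single 0 1, EuclideanSpace.single 1 1] *
        Ω₀ ![EuclideanSpace.single 2 1, EuclideanSpace.single 3 1] -
      Ω₀ ![EuclideanSpace.single 0 1, EuclideanSpace.single 2 1] *
        Ω₀ ![EuclideanSpace.single 1 1, EuclideanSpace.single 3 1] +
      Ω₀ ![EuclideanSpace.single 0 1, EuclideanSpace.single 3 1] *
        Ω₀ ![EuclideanSpace.single 1 1, EuclideanSpace.single 2 1] with hP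
  have hP0 : P ≠ 0 := hPfnz Ω₀ (hnd c (mem_ball_self hρ))
  -- a Lipschitz bound for `Ωc` at `c` on the closed half-ball
  have hK : IsCompact (closedBall c (ρ / 2)) := isCompact_closedBall _ _
  have hsub : closedBall c (ρ / 2) ⊆ ball c ρ := closedBall_subset_ball (by linarith)
  have hdiff : ∀ x ∈ ball c ρ, DifferentiableAt ℝ Ωc x := fun x hx =>
    (hs.contDiffAt (isOpen_ball.mem_nhds hx)).differentiableAt (by simp)
  have hfc : ContinuousOn (fderiv ℝ Ωc) (ball c ρ) :=
    (hs.continuousOn_fderiv_of_isOpen isOpen_ball (by simp))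
  obtain ⟨M₀, hM₀⟩ := hK.exists_bound_of_continuousOn (f := fderiv ℝ Ωc) (hfc.mono hsub)
  set M : ℝ := max M₀ 0 with hMdef
  have hM0 : 0 ≤ M := le_max_right _ _
  have hM : ∀ x ∈ closedBall c (ρ / 2), ‖Ωc x - Ω₀‖ ≤ M * ‖x - c‖ := by
    intro x hx
    have hb : ∀ y ∈ closedBall c (ρ / 2), ‖fderiv ℝ Ωc y‖ ≤ M := fun y hy =>
      (hM₀ y hy).trans (le_max_left M₀ 0)
    exact (convex_closedBall c (ρ / 2)).norm_image_sub_le_of_norm_fderiv_le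
      (fun y hy => hdiff y (hsub hy)) hb (mem_closedBall_self (by linarith)) hx
  -- the smallness radius
  set B : ℝ := ‖Ω₀‖ + M * ρ with hB
  have hB0 : 0 ≤ B := by positivity
  set D : ℝ := 6 * (C * B + 2⁻¹ * ‖Ω₀‖ * M) + 1 with hD
  have hD0 : 0 < D := by positivity
  refine ⟨min (ρ / 4) (|P| / (2 * D)), lt_min (by linarith) (div_pos (abs_pos.2 hP0) (by positivity)),
    fun r hr hr1 => ?_⟩
  have hrρ : r < ρ / 4 := lt_of_lt_of_le hr1 (min_le_left _ _)
  have hrP : r < |P| / (2 * D) := lt_of_lt_of_le hr1 (min_le_right _ _)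
  have hr0 : r ≠ 0 := hr.ne'
  -- points `c + r u` with `‖u‖ < 2` lie in the half-ball
  have hmem : ∀ u : (EuclideanSpace ℝ (Fin 4)), ‖u‖ < 2 → c + r • u ∈ ball c ρ := by
    intro u hu
    rw [mem_ball, dist_eq_norm, add_sub_cancel_left, norm_smul, Real.norm_eq_abs, abs_of_pos hr]
    nlinarith
  have hmem' : ∀ u : (EuclideanSpace ℝ (Fin 4)), ‖u‖ = 1 → c + r • u ∈ closedBall c (ρ / 2) := by
    intro u hu
    rw [mem_closedBall, dist_eq_norm, add_sub_cancel_left, norm_smul, Real.norm_eq_abs,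
      abs_of_pos hr, hu, mul_one]
    linarith
  -- the raw rescaled primitive, smooth on the ball of radius 2
  set θr : (EuclideanSpace ℝ (Fin 4)) → (EuclideanSpace ℝ (Fin 4)) →L[ℝ] ℝ := fun u => r⁻¹ • T (Λ (c + r • u)) with hθr
  have hA : ContDiff ℝ ∞ fun u : (EuclideanSpace ℝ (Fin 4)) => c + r • u := contDiff_const.add (contDiff_const_smul r)
  have hθrs : ContDiffOn ℝ ∞ θr (ball (0 : (EuclideanSpace ℝ (Fin 4))) 2) := by
    have h1 : ContDiffOn ℝ ∞ (fun u : (EuclideanSpace ℝ (Fin 4)) => Λ (c + r • u)) (ball (0 : (EuclideanSpace ℝ (Fin 4))) 2) :=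
      hΛs.comp hA.contDiffOn fun u hu => hmem u (by simpa using hu)
    exact (T.contDiff.comp_contDiffOn h1).const_smul r⁻¹
  obtain ⟨θ, hθ, hθeq⟩ := exists_contDiff_eventuallyEq_of_contDiffOn_ball hθrs
  refine ⟨θ, hθ, ?_, ?_⟩
  · -- clause (i): the contact condition, by perturbation from the linear model
    intro u hu v hvu hv
    have hu1 : u ∈ closedBall (0 : (EuclideanSpace ℝ (Fin 4))) 1 := by simp [hu]
    have hθu : θ u = θr u := (hθeq u hu1).self_of_nhds
    rw [hθu]
    set x : (EuclideanSpace ℝ (Fin 4)) := c + r • u with hx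
    have hxc : x - c = r • u := by rw [hx]; abel
    have hxmem : x ∈ closedBall c (ρ / 2) := hmem' u hu
    have hnxc : ‖x - c‖ = r := by
      rw [hxc, norm_smul, Real.norm_eq_abs, abs_of_pos hr, hu, mul_one]
    -- the model covector `θ₀(a) = ½ Ω₀(u, a)`
    obtain ⟨θ₀, hθ₀⟩ : ∃ θ₀ : (EuclideanSpace ℝ (Fin 4)) →L[ℝ] ℝ, ∀ a, θ₀ a = 2⁻¹ * Ω₀ ![u, a] :=
      ⟨(2⁻¹ : ℝ) • T (Ω₀.curryLeft u), fun a => by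
        rw [FunLike.coe_smul, Pi.smul_apply, hT, ContinuousAlternatingMap.curryLeft_apply_apply,
          smul_eq_mul]⟩
    -- values of the raw primitive
    have hθra : ∀ a, θr u a = r⁻¹ * Λ x ![a] := fun a => by
      rw [hθr]
      change (r⁻¹ • T (Λ (c + r • u))) a = r⁻¹ * Λ x ![a]
      rw [FunLike.coe_smul, Pi.smul_apply, hT, smul_eq_mul]
    -- `‖θr u - θ₀‖ ≤ C r`
    have h1 : ‖θr u - θ₀‖ ≤ C * r := by
      refine opNorm_sub_le_of_bound _ _ (by positivity) fun a => ?_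
      have hΩ : Ω₀ ![x - c, a] = r * Ω₀ ![u, a] := by rw [hxc, two_form_smul_left]
      have e : θr u a - θ₀ a = r⁻¹ * (Λ x ![a] - 2⁻¹ * Ω₀ ![x - c, a]) := by
        rw [hθra, hθ₀, hΩ]
        field_simp
      rw [e, abs_mul, abs_of_pos (inv_pos.2 hr)]
      have h := hC x hxmem a
      rw [hnxc] at h
      calc r⁻¹ * |Λ x ![a] - 2⁻¹ * Ω₀ ![x - c, a]| ≤ r⁻¹ * (C * r ^ 2 * ‖a‖) := by gcongr
        _ = C * r * ‖a‖ := by field_simp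
    -- `‖Ωc x - Ω₀‖ ≤ M r`, `‖Ωc x‖ ≤ B`, `‖θ₀‖ ≤ ½ ‖Ω₀‖`
    have h2 : ‖Ωc x - Ω₀‖ ≤ M * r := by
      have h := hM x hxmem
      rwa [hnxc] at h
    have h3 : ‖Ωc x‖ ≤ B := by
      have : ‖Ωc x‖ ≤ ‖Ωc x - Ω₀‖ + ‖Ω₀‖ := norm_le_norm_sub_add _ _
      have : M * r ≤ M * ρ := by apply mul_le_mul_of_nonneg_left _ hM0; linarith
      rw [hB]; linarith
    have h4 : ‖θ₀‖ ≤ 2⁻¹ * ‖Ω₀‖ := by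
      refine ContinuousLinearMap.opNorm_le_bound _ (by positivity) fun a => ?_
      rw [hθ₀, Real.norm_eq_abs, abs_mul, abs_of_pos (by norm_num : (0 : ℝ) < 2⁻¹)]
      have h := abs_two_form_le Ω₀ u a
      rw [hu, mul_one] at h
      nlinarith
    -- smallness
    have hsmall : 3 * (‖θr u - θ₀‖ * ‖Ωc x‖ + ‖θ₀‖ * ‖Ωc x - Ω₀‖) < |P| / 2 := by
      have e1 : ‖θr u - θ₀‖ * ‖Ωc x‖ ≤ C * r * B :=
        mul_le_mul h1 h3 (norm_nonneg _) (by positivity)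
      have e2 : ‖θ₀‖ * ‖Ωc x - Ω₀‖ ≤ 2⁻¹ * ‖Ω₀‖ * (M * r) :=
        mul_le_mul h4 h2 (norm_nonneg _) (by positivity)
      have e3 : 3 * (C * r * B + 2⁻¹ * ‖Ω₀‖ * (M * r)) ≤ D * r := by
        have p1 : 0 ≤ C * r * B := by positivity
        have p2 : 0 ≤ ‖Ω₀‖ * (M * r) := by positivity
        have eD : D * r = 6 * (C * r * B) + 3 * (‖Ω₀‖ * (M * r)) + r := by rw [hD]; ring
        rw [eD]
        linarith
      have e4 : D * r < |P| / 2 := by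
        rw [lt_div_iff₀ (by positivity : (0 : ℝ) < 2 * D)] at hrP
        linarith
      linarith
    have hPf₀ : ∀ w : Fin 4 → (EuclideanSpace ℝ (Fin 4)), Ω₀ ![w 0, w 1] * Ω₀ ![w 2, w 3] - Ω₀ ![w 0, w 2] * Ω₀ ![w 1, w 3] +
        Ω₀ ![w 0, w 3] * Ω₀ ![w 1, w 2] = P * (Matrix.of fun i j => w i j).det := fun w => by
      rw [hP]; exact hPf Ω₀ w
    exact bracket_ne_zero_of_perturbation Ω₀ P hPf₀ hprop u hu (θr u) θ₀ hθ₀ (Ωc x) hsmall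
      v hvu hv
  · -- clause (ii): `dθ = σ` exactly
    intro u hu v hvu hker w hwu
    have hu1 : u ∈ closedBall (0 : (EuclideanSpace ℝ (Fin 4))) 1 := by simp [hu]
    rw [(hθeq u hu1).fderiv_eq]
    have hxball : c + r • u ∈ ball c ρ := hmem u (by rw [hu]; norm_num)
    have hΛd : DifferentiableAt ℝ Λ (c + r • u) :=
      (hΛs.contDiffAt (isOpen_ball.mem_nhds hxball)).differentiableAt (by simp)
    rw [hθr, fderiv_rescaled_sub T hT Λ c hr0 u hΛd v w, hdΛ _ hxball]
    exact hker w hwu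

/-- **SMALL SPHERES AROUND A POINT OF A SYMPLECTIC CHART ARE STABILISED (contact type)** —
unconditional form of `exists_isStabilising_smallSphere_of`, the elementary inputs being the tree
theorems `coneOperator_two_oneJet`, `pfaffian_identity_four`,
`pfaffian_ne_zero_of_nondegenerate_four`, `alternating_three_restrict_orthogonal_four`.
McDuff–Salamon (2017) §3.5 (every point of a symplectic manifold has arbitrarily small
neighbourhoods with boundary of contact type); Cieliebak–Volkov (2015) §1 (contact ⇒ stable).
[cite: McDuffSalamon2017, §3.5] -/
theorem exists_isStabilising_smallSphere
    (Ωc : (EuclideanSpace ℝ (Fin 4)) → (EuclideanSpace ℝ (Fin 4)) [⋀^Fin 2]→L[ℝ] ℝ)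
    (c : (EuclideanSpace ℝ (Fin 4))) (ρ : ℝ) (hρ : 0 < ρ)
    (hs : ContDiffOn ℝ ∞ Ωc (ball c ρ)) (hcl : ∀ y ∈ ball c ρ, extDeriv Ωc y = 0)
    (hnd : ∀ y ∈ ball c ρ, ∀ v : (EuclideanSpace ℝ (Fin 4)), v ≠ 0 → ∃ w, Ωc y ![v, w] ≠ 0) :
    ∃ r₁ : ℝ, 0 < r₁ ∧ ∀ r : ℝ, 0 < r → r < r₁ →
      ∃ θ : (EuclideanSpace ℝ (Fin 4)) → (EuclideanSpace ℝ (Fin 4)) →L[ℝ] ℝ, ContDiff ℝ ∞ θ ∧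
        (∀ u : (EuclideanSpace ℝ (Fin 4)), ‖u‖ = 1 → ∀ v : Fin 3 → (EuclideanSpace ℝ (Fin 4)),
          (∀ i, ⟪v i, u⟫ = 0) → LinearIndependent ℝ v →
          θ u (v 0) * Ωc (c + r • u) ![v 1, v 2] - θ u (v 1) * Ωc (c + r • u) ![v 0, v 2] +
            θ u (v 2) * Ωc (c + r • u) ![v 0, v 1] ≠ 0) ∧
        (∀ u : (EuclideanSpace ℝ (Fin 4)), ‖u‖ = 1 → ∀ v : (EuclideanSpace ℝ (Fin 4)), ⟪v, u⟫ = 0 →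
          (∀ w : (EuclideanSpace ℝ (Fin 4)), ⟪w, u⟫ = 0 → Ωc (c + r • u) ![v, w] = 0) →
          ∀ w : (EuclideanSpace ℝ (Fin 4)), ⟪w, u⟫ = 0 → fderiv ℝ θ u v w - fderiv ℝ θ u w v = 0) :=
  exists_isStabilising_smallSphere_of Literature.Geometry.Kaehler.coneOperator_two_oneJet
    pfaffian_identity_four pfaffian_ne_zero_of_nondegenerate_four
    alternating_three_restrict_orthogonal_four Ωc c ρ hρ hs hcl hnd

end Literature.Geometry.Symplectic

end
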